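import Summits.BirchSwinnertonDyer.BirchSwinnertonDyer.Theorems.AdditiveKolyvaginRoadLevelSystemsCanonicalUpperLevelsCheb
import Summits.BirchSwinnertonDyer.BirchSwinnertonDyer.Theorems.AdditiveKolyvaginRoadLevelSystemsCoreConnectedOfPoitouTate
import Summits.BirchSwinnertonDyer.BirchSwinnertonDyer.Theorems.AdditiveKolyvaginRoadLevelSystemsHybrid
import Summits.BirchSwinnertonDyer.BirchSwinnertonDyer.Theorems.AdditiveKolyvaginRoadChebOfMcCallum
import Summits.BirchSwinnertonDyer.BirchSwinnertonDyer.Theorems.AdditiveKolyvaginRoadLevelMembership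
import HarnessLib

/-!
# Route `AdditiveKolyvaginRoad`, crux KS′ `LevelKolyvaginSystemsAdditive` (item stmt-BirchSwinnertonDyer-21396):
# THE FIBRE OF KS′ AT A FRAME FROM ONE SEED — `Nonempty (LevelKolyvaginSystemP …)` from a non-zero Kolyvagin class mod `p`, Poitou–Tate,
# odd bottom rank, and the TWIN DICHOTOMY for the mixed Selmer spaces (the one displayed E-side input) — no Zhang datum, no lender
# (cell `pub/bsd-wall`, width seat `bsd-wall-akr-p2x-w2` g6 on line `epsilon_matched_retyping`; `--supports stmt-BirchSwinnertonDyer-21396`, helper;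
# E-side instantiation of the engine `CoreGraph.exists_canonicalUpperLevels_of_cheb`, parts 1–2 of this seat)

WHY. The crux-triage finding on KS′ (`Cruxes/LevelKolyvaginSystemsAdditive/TRIAGE-r1-1.md` v17 §1, reading (α): «KS′ ≡ KPA′ modulo E-side
bookkeeping») says the carrier `LevelKolyvaginSystemP` — realisation at level `∅`, and at the NON-EMPTY levels the signed memberships, W. Zhang's
relation (8.1), `transport`, `baseCase` — is inhabited, at any frame carrying ONE non-zero Kolyvagin class mod `p`, by CANONICAL LINES in the
mixed Selmer spaces. Parts 1–2 (`…CanonicalUpperLevels`, `…CanonicalUpperLevelsCheb`) proved the upper-level half in ENGINE currency. THIS FILE is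
the E-side instantiation at a frame `(E, p, K, c)` (`E = W` globally minimal, `p ≥ 5` with `ρ̄_{E,p}` onto — ANY reduction type at `p` —, `K`
imaginary quadratic Heegner for `N_E`, `4N_E ∣ β² − d_K`, `c ≠ 1`):
* §1 `exists_mixedSpaces` — the MIXED spaces `Sel(m, n)^μ ⊂ H¹(K, E[p])` (μ-eigen; Kummer at `∞` and off `m ∪ n`; TORIC on the admissible
  level `n`; TRANSVERSE on the Kolyvagin conductor `m`) exist as finite `ZMod p`-subspaces, given by a membership DICTIONARY (no definition
  is introduced: `levelSelmerSubgroupP n ↑m μ ⊓ toric ⊓ transverse`, finite by `finite_levelSelmerSubgroupP`); `mixed_empty_eq_selQP` — at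
  conductor `∅` they are the canonical spaces `SelQP`.
* §2 `cheb1_mixed`, `cheb2_mixed` — Čebotarev in the CONDUCTOR direction (McCallum 1991 Cor. 3.2 for eigenclasses, tree theorem
  `exists_zhangKolyvaginPrime_notMem_of_eigenP`): non-zero classes (one, or one of each sign) are detected above a Kolyvagin prime outside
  any finite set.
* §3 `odd_total_mixed_empty_iff` — the total rank at conductor `∅` is odd exactly at the even levels, from ODD bottom rank, by the tree's
  `CoreGraph.odd_total_iff_even_card` with the `SelQP` dischargers of `selQP_coreConnected` ((Equiv), (Inert), (Lower), (R′) ⟸ Poitou–Tate).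
* §4 `nonempty_levelKolyvaginSystemP_of_seed_of_twin` — THE RESULT: `Nonempty (LevelKolyvaginSystemP W K p Dt β ι c)` from
  `poitouTate_selmerStructure_duality K`, `dim Sel_p(E/K)` odd, the mixed spaces with their dictionary, the TWIN DICHOTOMY for them at
  every non-empty level (`hDrop` ∕ `hRise` ∕ `hJump`, Howard 2004 Lemma 2.5.3 — HYPOTHESES), and ONE SEED (a Kolyvagin–Heegner datum of
  Kolyvagin-prime conductor with non-zero class mod `p` = the conclusion of crux r2 `KolyvaginPrimitiveAdditive` at the frame): the
  hybrid socket `nonempty_levelKolyvaginSystemP_of_upperLevels_of_bottomTransfer` fed with the canonical lines.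

WHAT IT MEANS FOR THE LINE `epsilon_matched_retyping` (skeleton v9: S1′ `stub_offGoodAvatarDatumLocus` + S0). On the GOOD-avatar locus the seed
for `E` is a tree theorem through Kriz–Li (`kolyvaginPrimitiveAdditive_conclusion_on_gammaLocus`, w3 g6; `exists_kolyvaginClass_ne_zero_of_thm116_of_sign`),
so KS′ there follows from this file WITHOUT W. Zhang's displayed bipartite datum, WITHOUT the lender's level system, (Tam), (θK)ₚ — modulo
(Twin). At the route level: crux r8 KS′ ⟸ crux r2 KPA′ + PUB + DUAL + (Twin), the kernel form of triage reading (α).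

HONEST FRAMING: theorems only; 0 definitions, 0 named facts, 0 `sorry`; (Twin) for the mixed spaces, Poitou–Tate, the parity and the seed are
HYPOTHESES. (Twin)'s drop half is Poitou–Tate-free (REC + `perf` + `line` of the tree's `KolyvaginLocalPackageP`); its rise half is
`hjump_of_poitouTateP` + the local trichotomy «an isotropic `s`-eigenclass at a Kolyvagin prime is Kummer or transverse there» — NOT in the tree
yet (this seat's next file). Closes nothing: KS′ quantifies over ALL ♯ frames and asks no seed. BSD is not proved by any of this.

References: [cite: Howard2004HeegnerKolyvagin, Lemma 2.5.3, Lemma 2.6.2, Lemma 2.6.4] [cite: McCallumLMS1991, Cor. 3.2]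
[cite: WZhang2014, Thm. 4.3, Lemma 5.3, Prop. 5.4, Thm. 7.2, §8.1 (8.1), §9] [cite: Howard2006Bipartite, Cor. 2.3.5]
[cite: GrossLMS1991, §4 (4.4)].
-/

set_option linter.dupNamespace false -- single-conjunct summit repeats the name by design

noncomputable section

open scoped Classical

namespace Summit.BirchSwinnertonDyer.BirchSwinnertonDyer.Theorems.AdditiveKoly

open WeierstrassCurve NumberField IsDedekindDomain Field
  Literature.NumberTheory.EllipticCurves Literature.NumberTheory.EllipticCurves.ModularForms
  Literature.NumberTheory.EllipticCurves.Rank1Residual Literature.NumberTheory.GaloisRepresentations Module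
  Summit.BirchSwinnertonDyer.Rank1Residual.X11b.Three.Koly

variable (W : WeierstrassCurve ℚ) (K : Type) [Field K] [NumberField K] (p : ℕ) [W.IsElliptic] [W.IsGloballyMinimal]
  [Fact p.Prime] (c : K ≃ₐ[ℚ] K) (ι : K →+* ℂ) [Module (ZMod p) (Vp W K p)]

/-! ## §1 The MIXED level spaces `Sel(m, n)^μ` (Kummer off `m ∪ n`, toric on `n`, transverse on `m`): existence, finiteness -/

/-- **The mixed level spaces exist as `ZMod p`-subspaces of `H¹(K, E[p])` and are finite-dimensional.** For every conductor `m`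
(a finite set of Kolyvagin primes), level `n` (a finite set of admissible primes) and sign `μ` there is a subspace whose members are
EXACTLY the `μ`-eigenclasses of complex conjugation satisfying E's Kummer condition at every infinite place and at every finite place
above no prime of `m ∪ n`, the TORIC condition above the primes of `n` and the TRANSVERSE condition above the primes of `m`
(W. Zhang's `Sel` of the structure `F(m)(n)`; the carrier's `sign` ∕ `selmer_off` ∕ `selmer_inf` ∕ `toric_on` ∕ `transverse_on` rows);
it is finite (it lies in the tree's `levelSelmerSubgroupP n ↑m μ`, finite by `finite_levelSelmerSubgroupP`). Stated as an existence with a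
membership dictionary, so that no definition is introduced. [cite: WZhang2014, §5 (Sel), §8.1] [cite: Howard2004HeegnerKolyvagin, §2.2] -/
theorem exists_mixedSpaces :
    ∃ Mix : Finset {ℓ // Zhang2014.IsKolyvaginPrime (W.conductorNorm ℤ) W K p ℓ} → Finset (AdmQ W K p) → Bool → Submodule (ZMod p) (Vp W K p),
      (∀ (m : Finset {ℓ // Zhang2014.IsKolyvaginPrime (W.conductorNorm ℤ) W K p ℓ}) (n : Finset (AdmQ W K p)) (μ : Bool) (x : Vp W K p),
        x ∈ Mix m n μ ↔ (conjAct W c ((p ^ 1 : ℕ) : ℤ) x = sgnP μ • x ∧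
        (∀ w : InfinitePlace K, x ∈ selmerLocalKer (W.baseChange K) w.Completion ((p ^ 1 : ℕ) : ℤ)) ∧
        (∀ v : HeightOneSpectrum (𝓞 K), (∀ ℓ ∈ m, ((ℓ : ℕ) : 𝓞 K) ∉ v.asIdeal) → (∀ q ∈ n, ((q : ℕ) : 𝓞 K) ∉ v.asIdeal) →
          x ∈ selmerLocalKer (W.baseChange K) (v.adicCompletion K) ((p ^ 1 : ℕ) : ℤ)) ∧
        (∀ q ∈ n, ∀ v : HeightOneSpectrum (𝓞 K), ((q : ℕ) : 𝓞 K) ∈ v.asIdeal →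
          x ∈ toricLocalKer (W.baseChange K) (v.adicCompletion K) ((p ^ 1 : ℕ) : ℤ)) ∧
        (∀ ℓ ∈ m, ∀ v : HeightOneSpectrum (𝓞 K), ((ℓ : ℕ) : 𝓞 K) ∈ v.asIdeal → x ∈ transverseLocalKerP W K p ι ℓ v))) ∧
      (∀ (m : Finset {ℓ // Zhang2014.IsKolyvaginPrime (W.conductorNorm ℤ) W K p ℓ}) (n : Finset (AdmQ W K p)) (μ : Bool), Module.Finite (ZMod p) (Mix m n μ)) := by
  -- the spaces as additive subgroups
  let S : Finset {ℓ // Zhang2014.IsKolyvaginPrime (W.conductorNorm ℤ) W K p ℓ} → Finset (AdmQ W K p) → Bool → AddSubgroup (Vp W K p) := fun m n μ ↦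
    levelSelmerSubgroupP W K p c (n.image Subtype.val) (((m.image Subtype.val : Finset ℕ)) : Set ℕ) μ ⊓
    ((⨅ (q : AdmQ W K p) (_ : q ∈ n) (v : HeightOneSpectrum (𝓞 K)) (_ : ((q : ℕ) : 𝓞 K) ∈ v.asIdeal),
        toricLocalKer (W.baseChange K) (v.adicCompletion K) ((p ^ 1 : ℕ) : ℤ)) ⊓
     (⨅ (ℓ : {ℓ // Zhang2014.IsKolyvaginPrime (W.conductorNorm ℤ) W K p ℓ}) (_ : ℓ ∈ m) (v : HeightOneSpectrum (𝓞 K)) (_ : ((ℓ : ℕ) : 𝓞 K) ∈ v.asIdeal),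
        transverseLocalKerP W K p ι ℓ v))
  refine ⟨fun m n μ ↦ AddSubgroup.toZModSubmodule p (S m n μ), fun m n μ x ↦ ?_, fun m n μ ↦ ?_⟩
  · rw [AddSubgroup.mem_toZModSubmodule]
    change x ∈ _ ⊓ (_ ⊓ _) ↔ _
    rw [AddSubgroup.mem_inf, AddSubgroup.mem_inf, mem_levelSelmerSubgroupP_iff]
    simp only [AddSubgroup.mem_iInf]
    constructor
    · rintro ⟨⟨h1, h2, h3, -⟩, h5, h6⟩
      refine ⟨h1, h2, fun v hm hn ↦ h3 v fun q hq ↦ ?_, h5, h6⟩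
      rcases hq with hq | hq
      · rw [Finset.mem_coe, Finset.mem_image] at hq
        obtain ⟨a, ha, rfl⟩ := hq
        exact hn a ha
      · rw [Finset.mem_coe, Finset.mem_image] at hq
        obtain ⟨a, ha, rfl⟩ := hq
        exact hm a ha
    · rintro ⟨h1, h2, h3, h5, h6⟩
      refine ⟨⟨h1, h2, fun v hv ↦ h3 v (fun ℓ hℓ ↦ hv _ (Or.inr ?_)) (fun q hq ↦ hv _ (Or.inl ?_)), ?_⟩, h5, h6⟩
      · rw [Finset.mem_coe, Finset.mem_image]; exact ⟨ℓ, hℓ, rfl⟩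
      · rw [Finset.mem_coe, Finset.mem_image]; exact ⟨q, hq, rfl⟩
      · rintro q ⟨hq, -⟩ v hv
        rw [Finset.mem_image] at hq
        obtain ⟨a, ha, rfl⟩ := hq
        exact h5 a ha v hv
  · -- finiteness: inside the finite `levelSelmerSubgroupP`
    have h0 : (0 : ℕ) ∉ ((n.image Subtype.val : Finset ℕ) : Set ℕ) ∪ (((m.image Subtype.val : Finset ℕ)) : Set ℕ) := by
      rintro (h | h)
      · rw [Finset.mem_coe, Finset.mem_image] at h
        obtain ⟨q, -, hq⟩ := h
        exact q.2.1.ne_zero hq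
      · rw [Finset.mem_coe, Finset.mem_image] at h
        obtain ⟨ℓ, -, hℓ⟩ := h
        exact ℓ.2.1.ne_zero hℓ
    have hfin : Finite (levelSelmerSubgroupP W K p c (n.image Subtype.val) (((m.image Subtype.val : Finset ℕ)) : Set ℕ) μ) :=
      finite_levelSelmerSubgroupP W K p c _ _ (Finset.finite_toSet _) h0 μ
    have hle : S m n μ ≤ levelSelmerSubgroupP W K p c (n.image Subtype.val) (((m.image Subtype.val : Finset ℕ)) : Set ℕ) μ :=
      inf_le_left
    have hfin' : Finite (S m n μ) := Finite.of_injective _ (AddSubgroup.inclusion_injective hle)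
    have hfin'' : Finite (AddSubgroup.toZModSubmodule p (S m n μ)) :=
      Finite.of_equiv _ (Equiv.setCongr (AddSubgroup.coe_toZModSubmodule p _).symm)
    exact Module.Finite.of_finite

omit [W.IsElliptic] in
/-- At conductor `∅` the mixed space is the canonical space `SelQP`. [cite: WZhang2014, §5 (Sel)] -/
theorem mixed_empty_eq_selQP (Mix : Finset {ℓ // Zhang2014.IsKolyvaginPrime (W.conductorNorm ℤ) W K p ℓ} → Finset (AdmQ W K p) → Bool → Submodule (ZMod p) (Vp W K p))
    (hMix : ∀ (m : Finset {ℓ // Zhang2014.IsKolyvaginPrime (W.conductorNorm ℤ) W K p ℓ}) (n : Finset (AdmQ W K p)) (μ : Bool) (x : Vp W K p),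
      x ∈ Mix m n μ ↔ (conjAct W c ((p ^ 1 : ℕ) : ℤ) x = sgnP μ • x ∧
        (∀ w : InfinitePlace K, x ∈ selmerLocalKer (W.baseChange K) w.Completion ((p ^ 1 : ℕ) : ℤ)) ∧
        (∀ v : HeightOneSpectrum (𝓞 K), (∀ ℓ ∈ m, ((ℓ : ℕ) : 𝓞 K) ∉ v.asIdeal) → (∀ q ∈ n, ((q : ℕ) : 𝓞 K) ∉ v.asIdeal) →
          x ∈ selmerLocalKer (W.baseChange K) (v.adicCompletion K) ((p ^ 1 : ℕ) : ℤ)) ∧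
        (∀ q ∈ n, ∀ v : HeightOneSpectrum (𝓞 K), ((q : ℕ) : 𝓞 K) ∈ v.asIdeal →
          x ∈ toricLocalKer (W.baseChange K) (v.adicCompletion K) ((p ^ 1 : ℕ) : ℤ)) ∧
        (∀ ℓ ∈ m, ∀ v : HeightOneSpectrum (𝓞 K), ((ℓ : ℕ) : 𝓞 K) ∈ v.asIdeal → x ∈ transverseLocalKerP W K p ι ℓ v)))
    (n : Finset (AdmQ W K p)) (μ : Bool) : Mix ∅ n μ = SelQP W K p c n μ := by
  ext x
  rw [hMix, mem_selQP_iff]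
  simp only [Finset.notMem_empty, false_imp_iff, imp_true_iff, forall_const, and_true]

/-! ## §2 Čebotarev in the conductor direction for the mixed spaces (McCallum Cor. 3.2) -/

omit [Module (ZMod p) (Vp W K p)] [W.IsElliptic] [Fact p.Prime] in
/-- A place of `K` above a Kolyvagin prime. [folklore] -/
theorem exists_place_of_kolyvaginPrime (ℓ : {ℓ // Zhang2014.IsKolyvaginPrime (W.conductorNorm ℤ) W K p ℓ}) :
    ∃ v : HeightOneSpectrum (𝓞 K), ((ℓ : ℕ) : 𝓞 K) ∈ v.asIdeal := by
  have hℓP : (Ideal.span {((ℓ : ℕ) : 𝓞 K)}).IsPrime := ℓ.2.2.2.2.2.1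
  have hbot : Ideal.span {((ℓ : ℕ) : 𝓞 K)} ≠ ⊥ := by
    rw [Ne, Ideal.span_singleton_eq_bot]
    exact_mod_cast ℓ.2.1.ne_zero
  exact ⟨⟨Ideal.span {((ℓ : ℕ) : 𝓞 K)}, hℓP, hbot⟩, Ideal.subset_span rfl⟩

/-- **(Cheb1) for the mixed spaces**: a non-zero class of `Sel(m, n)^μ` is detected above a Kolyvagin prime outside any finite set
(McCallum 1991 Cor. 3.2 for one eigenclass — tree `exists_zhangKolyvaginPrime_notMem_of_eigenP`; `K` imaginary quadratic, `p` odd,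
`ρ̄_{E,p}` onto, `c ≠ 1`). [cite: McCallumLMS1991, Cor. 3.2] -/
theorem cheb1_mixed [NeZero (W.conductorNorm ℤ)] (hK : IsImaginaryQuadratic K) (hp2 : p ≠ 2)
    (hsurj : W.HasSurjectiveModNGaloisRep p) (hc : c ≠ 1) (Mix : Finset {ℓ // Zhang2014.IsKolyvaginPrime (W.conductorNorm ℤ) W K p ℓ} → Finset (AdmQ W K p) → Bool → Submodule (ZMod p) (Vp W K p))
    (hMix : ∀ (m : Finset {ℓ // Zhang2014.IsKolyvaginPrime (W.conductorNorm ℤ) W K p ℓ}) (n : Finset (AdmQ W K p)) (μ : Bool) (x : Vp W K p),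
      x ∈ Mix m n μ ↔ (conjAct W c ((p ^ 1 : ℕ) : ℤ) x = sgnP μ • x ∧
        (∀ w : InfinitePlace K, x ∈ selmerLocalKer (W.baseChange K) w.Completion ((p ^ 1 : ℕ) : ℤ)) ∧
        (∀ v : HeightOneSpectrum (𝓞 K), (∀ ℓ ∈ m, ((ℓ : ℕ) : 𝓞 K) ∉ v.asIdeal) → (∀ q ∈ n, ((q : ℕ) : 𝓞 K) ∉ v.asIdeal) →
          x ∈ selmerLocalKer (W.baseChange K) (v.adicCompletion K) ((p ^ 1 : ℕ) : ℤ)) ∧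
        (∀ q ∈ n, ∀ v : HeightOneSpectrum (𝓞 K), ((q : ℕ) : 𝓞 K) ∈ v.asIdeal →
          x ∈ toricLocalKer (W.baseChange K) (v.adicCompletion K) ((p ^ 1 : ℕ) : ℤ)) ∧
        (∀ ℓ ∈ m, ∀ v : HeightOneSpectrum (𝓞 K), ((ℓ : ℕ) : 𝓞 K) ∈ v.asIdeal → x ∈ transverseLocalKerP W K p ι ℓ v))) :
    ∀ (B m : Finset {ℓ // Zhang2014.IsKolyvaginPrime (W.conductorNorm ℤ) W K p ℓ}) (n : Finset (AdmQ W K p)) (μ : Bool) (x : Vp W K p), n.Nonempty → x ∈ Mix m n μ →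
      x ≠ 0 → ∃ ℓ, ℓ ∉ B ∧ ¬ (∀ v : HeightOneSpectrum (𝓞 K), ((ℓ : ℕ) : 𝓞 K) ∈ v.asIdeal → x ∈ (W.baseChange K).torsionLocalKer (v.adicCompletion K) ((p ^ 1 : ℕ) : ℤ)) := by
  intro B m n μ x _ hx hx0
  have hxτ := ((hMix m n μ x).mp hx).1
  have hes : sgnP μ = 1 ∨ sgnP μ = -1 := by cases μ <;> simp [sgnP]
  obtain ⟨ℓ, hℓB, hℓ⟩ := exists_zhangKolyvaginPrime_notMem_of_eigenP W K p c hK hp2 hsurj hc ![x]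
    (fun i ↦ by fin_cases i; exact ⟨sgnP μ, hes, hxτ⟩) ![1] (fun i ↦ by fin_cases i; simp)
    (fun a ha i ↦ by
      fin_cases i
      simp only [Fin.sum_univ_one, Matrix.cons_val_zero] at ha
      exact dvd_of_zsmul_eq_zero_P W K p hx0 ha) B
  obtain ⟨v, hv⟩ := exists_place_of_kolyvaginPrime W K p ℓ
  refine ⟨ℓ, hℓB, fun hall ↦ ?_⟩
  have h := (hℓ 0 v hv).mp (hall v hv)
  simp at h

/-- **(Cheb2) for the mixed spaces**: non-zero classes of the two signs are simultaneously detected above a Kolyvagin prime outside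
any finite set (McCallum 1991 Cor. 3.2 for two independent eigenclasses). [cite: McCallumLMS1991, Cor. 3.2] -/
theorem cheb2_mixed [NeZero (W.conductorNorm ℤ)] (hK : IsImaginaryQuadratic K) (hp2 : p ≠ 2)
    (hsurj : W.HasSurjectiveModNGaloisRep p) (hc : c ≠ 1) (Mix : Finset {ℓ // Zhang2014.IsKolyvaginPrime (W.conductorNorm ℤ) W K p ℓ} → Finset (AdmQ W K p) → Bool → Submodule (ZMod p) (Vp W K p))
    (hMix : ∀ (m : Finset {ℓ // Zhang2014.IsKolyvaginPrime (W.conductorNorm ℤ) W K p ℓ}) (n : Finset (AdmQ W K p)) (μ : Bool) (x : Vp W K p),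
      x ∈ Mix m n μ ↔ (conjAct W c ((p ^ 1 : ℕ) : ℤ) x = sgnP μ • x ∧
        (∀ w : InfinitePlace K, x ∈ selmerLocalKer (W.baseChange K) w.Completion ((p ^ 1 : ℕ) : ℤ)) ∧
        (∀ v : HeightOneSpectrum (𝓞 K), (∀ ℓ ∈ m, ((ℓ : ℕ) : 𝓞 K) ∉ v.asIdeal) → (∀ q ∈ n, ((q : ℕ) : 𝓞 K) ∉ v.asIdeal) →
          x ∈ selmerLocalKer (W.baseChange K) (v.adicCompletion K) ((p ^ 1 : ℕ) : ℤ)) ∧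
        (∀ q ∈ n, ∀ v : HeightOneSpectrum (𝓞 K), ((q : ℕ) : 𝓞 K) ∈ v.asIdeal →
          x ∈ toricLocalKer (W.baseChange K) (v.adicCompletion K) ((p ^ 1 : ℕ) : ℤ)) ∧
        (∀ ℓ ∈ m, ∀ v : HeightOneSpectrum (𝓞 K), ((ℓ : ℕ) : 𝓞 K) ∈ v.asIdeal → x ∈ transverseLocalKerP W K p ι ℓ v))) :
    ∀ (B m : Finset {ℓ // Zhang2014.IsKolyvaginPrime (W.conductorNorm ℤ) W K p ℓ}) (n : Finset (AdmQ W K p)) (x y : Vp W K p), n.Nonempty → x ∈ Mix m n true → x ≠ 0 →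
      y ∈ Mix m n false → y ≠ 0 → ∃ ℓ, ℓ ∉ B ∧
        ¬ (∀ v : HeightOneSpectrum (𝓞 K), ((ℓ : ℕ) : 𝓞 K) ∈ v.asIdeal → x ∈ (W.baseChange K).torsionLocalKer (v.adicCompletion K) ((p ^ 1 : ℕ) : ℤ)) ∧
        ¬ (∀ v : HeightOneSpectrum (𝓞 K), ((ℓ : ℕ) : 𝓞 K) ∈ v.asIdeal → y ∈ (W.baseChange K).torsionLocalKer (v.adicCompletion K) ((p ^ 1 : ℕ) : ℤ)) := by
  intro B m n x y _ hx hx0 hy hy0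
  have hxτ : conjAct W c ((p ^ 1 : ℕ) : ℤ) x = (1 : ℤ) • x := ((hMix m n true x).mp hx).1
  have hyτ : conjAct W c ((p ^ 1 : ℕ) : ℤ) y = (-1 : ℤ) • y := ((hMix m n false y).mp hy).1
  obtain ⟨ℓ, hℓB, hℓ⟩ := exists_zhangKolyvaginPrime_notMem_of_eigenP W K p c hK hp2 hsurj hc ![x, y]
    (fun i ↦ by
      fin_cases i
      · exact ⟨1, Or.inl rfl, hxτ⟩
      · exact ⟨-1, Or.inr rfl, hyτ⟩)
    ![1, 1] (fun i ↦ by fin_cases i <;> simp)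
    (fun a ha ↦ by
      simp only [Fin.sum_univ_two, Matrix.cons_val_zero, Matrix.cons_val_one] at ha
      have h := dvd_and_dvd_of_zsmul_add_zsmul_eq_zero_P W K p hp2 (conjAct W c ((p ^ 1 : ℕ) : ℤ)) (Or.inl rfl) hxτ
        (by rw [neg_one_zsmul]; rw [neg_one_zsmul] at hyτ; exact hyτ) hx0 hy0 ha
      intro i
      fin_cases i
      · exact h.1
      · exact h.2) B
  obtain ⟨v, hv⟩ := exists_place_of_kolyvaginPrime W K p ℓ
  refine ⟨ℓ, hℓB, fun hall ↦ ?_, fun hall ↦ ?_⟩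
  · have h := (hℓ 0 v hv).mp (hall v hv)
    simp at h
  · have h := (hℓ 1 v hv).mp (hall v hv)
    simp at h

/-! ## §3 The parity of the total rank at conductor `∅` -/

/-- **The total canonical rank at conductor `∅` is odd exactly at the even levels**, granted ODD bottom rank: the tree's
`CoreGraph.odd_total_iff_even_card` for `SelQP`, with (Equiv) `localEquiv_of_admQ`, (Inert) `selQP_insert_eq_of_forall_mem_torsionLocalKer`,
(Lower) `selQP_lower_of_detected` and (R′) `selQP_raise_free` (Poitou–Tate) — the dischargers of `selQP_coreConnected` verbatim — read for
the mixed spaces at conductor `∅`. [cite: WZhang2014, Lemma 5.3, Prop. 5.4, §9 (9.2)] [cite: Howard2006Bipartite, Cor. 2.3.5] -/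
theorem odd_total_mixed_empty_iff (hK : IsImaginaryQuadratic K) (hp5 : 5 ≤ p) (hc1 : c ≠ 1)
    (hPT : Literature.NumberTheory.GaloisCohomology.poitouTate_selmerStructure_duality K)
    (hodd : Odd (finrank (ZMod p) (SelQP W K p c ∅ true) + finrank (ZMod p) (SelQP W K p c ∅ false)))
    (Mix : Finset {ℓ // Zhang2014.IsKolyvaginPrime (W.conductorNorm ℤ) W K p ℓ} → Finset (AdmQ W K p) → Bool → Submodule (ZMod p) (Vp W K p))
    (hMix : ∀ (m : Finset {ℓ // Zhang2014.IsKolyvaginPrime (W.conductorNorm ℤ) W K p ℓ}) (n : Finset (AdmQ W K p)) (μ : Bool) (x : Vp W K p),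
      x ∈ Mix m n μ ↔ (conjAct W c ((p ^ 1 : ℕ) : ℤ) x = sgnP μ • x ∧
        (∀ w : InfinitePlace K, x ∈ selmerLocalKer (W.baseChange K) w.Completion ((p ^ 1 : ℕ) : ℤ)) ∧
        (∀ v : HeightOneSpectrum (𝓞 K), (∀ ℓ ∈ m, ((ℓ : ℕ) : 𝓞 K) ∉ v.asIdeal) → (∀ q ∈ n, ((q : ℕ) : 𝓞 K) ∉ v.asIdeal) →
          x ∈ selmerLocalKer (W.baseChange K) (v.adicCompletion K) ((p ^ 1 : ℕ) : ℤ)) ∧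
        (∀ q ∈ n, ∀ v : HeightOneSpectrum (𝓞 K), ((q : ℕ) : 𝓞 K) ∈ v.asIdeal →
          x ∈ toricLocalKer (W.baseChange K) (v.adicCompletion K) ((p ^ 1 : ℕ) : ℤ)) ∧
        (∀ ℓ ∈ m, ∀ v : HeightOneSpectrum (𝓞 K), ((ℓ : ℕ) : 𝓞 K) ∈ v.asIdeal → x ∈ transverseLocalKerP W K p ι ℓ v)))
    (n : Finset (AdmQ W K p)) :
    Odd (finrank (ZMod p) (Mix ∅ n true) + finrank (ZMod p) (Mix ∅ n false)) ↔ Even n.card := by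
  rw [mixed_empty_eq_selQP W K p c ι Mix hMix n true, mixed_empty_eq_selQP W K p c ι Mix hMix n false]
  have hp : Odd p := (Fact.out : p.Prime).odd_of_ne_two (by omega)
  have hp2 : p ≠ 2 := by omega
  -- the sign of each admissible prime, by (Equiv)
  choose ε hε using localEquiv_of_admQ W K p hK.1 hc1
  have hInertT : ∀ (q : AdmQ W K p) (y : Vp W K p), conjAct W c ((p ^ 1 : ℕ) : ℤ) y = sgnP (!ε q) • y →
      ∀ v : HeightOneSpectrum (𝓞 K), ((q : ℕ) : 𝓞 K) ∈ v.asIdeal → y ∈ (W.baseChange K).torsionLocalKer (v.adicCompletion K) ((p ^ 1 : ℕ) : ℤ) :=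
    fun q y hy v hv ↦ mem_torsionLocalKer_of_localSign_ne W K p c hp (hε q v hv) hy
  refine CoreGraph.odd_total_iff_even_card (SelQP W K p c)
    (fun (q : AdmQ W K p) (y : Vp W K p) ↦ ∀ v : HeightOneSpectrum (𝓞 K), ((q : ℕ) : 𝓞 K) ∈ v.asIdeal → y ∈ (W.baseChange K).torsionLocalKer (v.adicCompletion K) ((p ^ 1 : ℕ) : ℤ)) ε
    (fun m q hqm ↦ selQP_insert_eq_of_forall_mem_torsionLocalKer W K p c m q hqm (!ε q) (hInertT q))
    (fun m q hqm hx ↦ ?_) (fun m q hqm hx ↦ selQP_raise_free W K p hK hp2 c hPT m q (ε q) hqm (hε q) hx) hodd n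
  obtain ⟨x, hx, hTx⟩ := hx
  obtain ⟨v, hv, hxv⟩ := (not_forall_mem_torsionLocalKer_iff W K p).mp hTx
  have hvx : (W.baseChange K).torsionLocMap (v.adicCompletion K) ((p ^ 1 : ℕ) : ℤ) x ≠ 0 := fun h ↦ hxv (AddMonoidHom.mem_ker.mpr h)
  obtain ⟨hle, hrank, htriv, -⟩ := selQP_lower_of_detected W K p c hK hp hc1 hqm hx hv hvx
  exact ⟨hle, hrank, htriv⟩

/-! ## §4 KS′'s conclusion at a frame from ONE SEED and the TWIN DICHOTOMY for the mixed spaces -/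

/-- **THE FIBRE OF KS′ AT A FRAME FROM ONE SEED, modulo the twin dichotomy for the mixed spaces.** Frame: `E = W` globally minimal,
`p ≥ 5`, `ρ̄_{E,p}` onto, `K` imaginary quadratic with the Heegner hypothesis for `N_E`, `4N_E ∣ β² − d_K`, `c ≠ 1` (NO reduction-type
hypothesis at `p`: additive, multiplicative or good alike). INPUTS: Poitou–Tate duality for Selmer structures over `K` (DUAL.2, named fact
`poitouTate_selmerStructure_duality K`); `dim_{𝔽_p} Sel_p(E/K)` ODD (`hodd`; at a ♯ frame: PUB + Cassels–Tate, tree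
`odd_finrank_selQP_empty_of_published`); the mixed spaces `Mix` with their membership dictionary and finiteness (`exists_mixedSpaces`); the TWIN
DICHOTOMY for them at every non-empty level (`hDrop` ∕ `hRise` ∕ `hJump`: Howard 2004 Lemma 2.5.3 — the ONE displayed E-side input, to be
discharged from the Kolyvagin-prime package + `hjump_of_poitouTateP`); and ONE SEED: some Kolyvagin–Heegner datum of Kolyvagin-prime conductor
has NON-ZERO class mod `p` (= the conclusion of crux r2 `KolyvaginPrimitiveAdditive` at the frame; on the good-avatar locus: Kriz–Li).
CONCLUSION: `LevelKolyvaginSystemP W K p Dt β ι c` is inhabited — the conclusion of crux KS′ at the frame. Proof: the hybrid socket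
`nonempty_levelKolyvaginSystemP_of_upperLevels_of_bottomTransfer` (level `∅` = any Kolyvagin–Heegner data + the seed) fed with CANONICAL LINES
(`CoreGraph.exists_canonicalUpperLevels_of_cheb`: Čebotarev = McCallum Cor. 3.2 `cheb1_mixed` ∕ `cheb2_mixed`, parity = §3). NO Zhang bipartite
datum, NO lender, NO reciprocity law, NO structure theorem for genuine classes. CONDITIONAL on (Twin); closes nothing by itself.
[cite: Howard2004HeegnerKolyvagin, Lemma 2.5.3, Lemma 2.6.4] [cite: McCallumLMS1991, Cor. 3.2] [cite: WZhang2014, Thm. 4.3, Thm. 7.2, §8.1, §9] -/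
theorem nonempty_levelKolyvaginSystemP_of_seed_of_twin [NeZero (W.conductorNorm ℤ)]
    (Dt : ModularParametrizationData W (W.conductorNorm ℤ)) (β : ℤ)
    (hK : IsImaginaryQuadratic K) (hp5 : 5 ≤ p) (hsurj : W.HasSurjectiveModNGaloisRep p) (hc1 : c ≠ 1)
    (hH : SatisfiesHeegnerHypothesis (W.conductorNorm ℤ) K) (hβ : (4 * (W.conductorNorm ℤ : ℤ)) ∣ β ^ 2 - NumberField.discr K)
    (hPT : Literature.NumberTheory.GaloisCohomology.poitouTate_selmerStructure_duality K)
    (hodd : Odd (finrank (ZMod p) (SelQP W K p c ∅ true) + finrank (ZMod p) (SelQP W K p c ∅ false)))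
    (Mix : Finset {ℓ // Zhang2014.IsKolyvaginPrime (W.conductorNorm ℤ) W K p ℓ} → Finset (AdmQ W K p) → Bool → Submodule (ZMod p) (Vp W K p))
    (hMix : ∀ (m : Finset {ℓ // Zhang2014.IsKolyvaginPrime (W.conductorNorm ℤ) W K p ℓ}) (n : Finset (AdmQ W K p)) (μ : Bool) (x : Vp W K p),
      x ∈ Mix m n μ ↔ (conjAct W c ((p ^ 1 : ℕ) : ℤ) x = sgnP μ • x ∧
        (∀ w : InfinitePlace K, x ∈ selmerLocalKer (W.baseChange K) w.Completion ((p ^ 1 : ℕ) : ℤ)) ∧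
        (∀ v : HeightOneSpectrum (𝓞 K), (∀ ℓ ∈ m, ((ℓ : ℕ) : 𝓞 K) ∉ v.asIdeal) → (∀ q ∈ n, ((q : ℕ) : 𝓞 K) ∉ v.asIdeal) →
          x ∈ selmerLocalKer (W.baseChange K) (v.adicCompletion K) ((p ^ 1 : ℕ) : ℤ)) ∧
        (∀ q ∈ n, ∀ v : HeightOneSpectrum (𝓞 K), ((q : ℕ) : 𝓞 K) ∈ v.asIdeal →
          x ∈ toricLocalKer (W.baseChange K) (v.adicCompletion K) ((p ^ 1 : ℕ) : ℤ)) ∧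
        (∀ ℓ ∈ m, ∀ v : HeightOneSpectrum (𝓞 K), ((ℓ : ℕ) : 𝓞 K) ∈ v.asIdeal → x ∈ transverseLocalKerP W K p ι ℓ v)))
    (hfin : ∀ (m : Finset {ℓ // Zhang2014.IsKolyvaginPrime (W.conductorNorm ℤ) W K p ℓ}) (n : Finset (AdmQ W K p)) (μ : Bool), Module.Finite (ZMod p) (Mix m n μ))
    (hDrop : ∀ (m : Finset {ℓ // Zhang2014.IsKolyvaginPrime (W.conductorNorm ℤ) W K p ℓ}) (ℓ : {ℓ // Zhang2014.IsKolyvaginPrime (W.conductorNorm ℤ) W K p ℓ}) (n : Finset (AdmQ W K p)) (μ : Bool), ℓ ∉ m → n.Nonempty →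
      (∃ x ∈ Mix m n μ, ¬ (∀ v : HeightOneSpectrum (𝓞 K), ((ℓ : ℕ) : 𝓞 K) ∈ v.asIdeal → x ∈ (W.baseChange K).torsionLocalKer (v.adicCompletion K) ((p ^ 1 : ℕ) : ℤ))) →
      (∀ y, y ∈ Mix (insert ℓ m) n μ ↔ (y ∈ Mix m n μ ∧ (∀ v : HeightOneSpectrum (𝓞 K), ((ℓ : ℕ) : 𝓞 K) ∈ v.asIdeal → y ∈ (W.baseChange K).torsionLocalKer (v.adicCompletion K) ((p ^ 1 : ℕ) : ℤ)))) ∧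
        finrank (ZMod p) (Mix (insert ℓ m) n μ) + 1 = finrank (ZMod p) (Mix m n μ))
    (hRise : ∀ (m : Finset {ℓ // Zhang2014.IsKolyvaginPrime (W.conductorNorm ℤ) W K p ℓ}) (ℓ : {ℓ // Zhang2014.IsKolyvaginPrime (W.conductorNorm ℤ) W K p ℓ}) (n : Finset (AdmQ W K p)) (μ : Bool), ℓ ∉ m → n.Nonempty →
      (∃ y ∈ Mix (insert ℓ m) n μ, ¬ (∀ v : HeightOneSpectrum (𝓞 K), ((ℓ : ℕ) : 𝓞 K) ∈ v.asIdeal → y ∈ (W.baseChange K).torsionLocalKer (v.adicCompletion K) ((p ^ 1 : ℕ) : ℤ))) →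
      (∀ x, x ∈ Mix m n μ ↔ (x ∈ Mix (insert ℓ m) n μ ∧ (∀ v : HeightOneSpectrum (𝓞 K), ((ℓ : ℕ) : 𝓞 K) ∈ v.asIdeal → x ∈ (W.baseChange K).torsionLocalKer (v.adicCompletion K) ((p ^ 1 : ℕ) : ℤ)))) ∧
        finrank (ZMod p) (Mix m n μ) + 1 = finrank (ZMod p) (Mix (insert ℓ m) n μ))
    (hJump : ∀ (m : Finset {ℓ // Zhang2014.IsKolyvaginPrime (W.conductorNorm ℤ) W K p ℓ}) (ℓ : {ℓ // Zhang2014.IsKolyvaginPrime (W.conductorNorm ℤ) W K p ℓ}) (n : Finset (AdmQ W K p)) (μ : Bool), ℓ ∉ m → n.Nonempty →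
      (∃ x ∈ Mix m n μ, ¬ (∀ v : HeightOneSpectrum (𝓞 K), ((ℓ : ℕ) : 𝓞 K) ∈ v.asIdeal → x ∈ (W.baseChange K).torsionLocalKer (v.adicCompletion K) ((p ^ 1 : ℕ) : ℤ))) ∨ (∃ y ∈ Mix (insert ℓ m) n μ, ¬ (∀ v : HeightOneSpectrum (𝓞 K), ((ℓ : ℕ) : 𝓞 K) ∈ v.asIdeal → y ∈ (W.baseChange K).torsionLocalKer (v.adicCompletion K) ((p ^ 1 : ℕ) : ℤ))))
    (seed : ∃ (m : Finset {ℓ // Zhang2014.IsKolyvaginPrime (W.conductorNorm ℤ) W K p ℓ}) (d : KolyvaginHeegnerData Dt β ι (∏ ℓ ∈ m, (ℓ : ℕ))),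
      d.kolyvaginClass (Fact.out : p.Prime) 1 ≠ 0) :
    Nonempty (LevelKolyvaginSystemP W K p Dt β ι c) := by
  have hp : p.Prime := Fact.out
  have hp2 : p ≠ 2 := by omega
  -- canonical lines at the upper levels (engine, Čebotarev form)
  obtain ⟨ε₀, κ, hmem, hrel, htrans, hbase, -⟩ := CoreGraph.exists_canonicalUpperLevels_of_cheb Mix
    (fun (ℓ : {ℓ // Zhang2014.IsKolyvaginPrime (W.conductorNorm ℤ) W K p ℓ}) (x : Vp W K p) ↦ ∀ v : HeightOneSpectrum (𝓞 K), ((ℓ : ℕ) : 𝓞 K) ∈ v.asIdeal → x ∈ (W.baseChange K).torsionLocalKer (v.adicCompletion K) ((p ^ 1 : ℕ) : ℤ))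
    (fun (q : AdmQ W K p) (x : Vp W K p) ↦ ∀ v : HeightOneSpectrum (𝓞 K), ((q : ℕ) : 𝓞 K) ∈ v.asIdeal → x ∈ (W.baseChange K).torsionLocalKer (v.adicCompletion K) ((p ^ 1 : ℕ) : ℤ))
    hfin (fun ℓ v _ ↦ AddSubgroup.zero_mem _) (fun ℓ a x hx v hv ↦ ZMod.smul_mem (hx v hv) a) (fun q v _ ↦ AddSubgroup.zero_mem _)
    hDrop hRise hJump (cheb1_mixed W K p c ι hK hp2 hsurj hc1 Mix hMix) (cheb2_mixed W K p c ι hK hp2 hsurj hc1 Mix hMix)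
    (fun n _ ↦ odd_total_mixed_empty_iff W K p c ι hK hp5 hc1 hPT hodd Mix hMix n)
  have hM := fun n hn m ↦ (hMix _ _ _ _).mp (hmem n hn m)
  refine nonempty_levelKolyvaginSystemP_of_upperLevels_of_bottomTransfer W K p c Dt β ι hK hH hβ ε₀ κ
    (fun n hn m ↦ (hM n hn m).1) (fun n hn m v hℓ hq ↦ (hM n hn m).2.2.1 v hℓ hq) (fun n hn m w ↦ (hM n hn m).2.1 w)
    (fun n hn m q hq v hv ↦ (hM n hn m).2.2.2.1 q hq v hv) (fun n hn m ℓ hℓ v hv ↦ (hM n hn m).2.2.2.2 ℓ hℓ v hv)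
    (fun n hn m ℓ hℓm v hv ↦ ?_) (fun n q₁ q₂ hn hq₁ hq₂ hbl ↦ ?_) (fun _ _ _ _ ↦ seed) (fun n hn _ h1 ↦ ?_)
  · -- relation: the place above the inert Kolyvagin prime is unique
    have huniq : ∀ v' : HeightOneSpectrum (𝓞 K), ((ℓ : ℕ) : 𝓞 K) ∈ v'.asIdeal → v' = v :=
      fun v' hv' ↦ Method2.placesAbove_eq_of_isPrime_span K ℓ.2.2.2.2.2.1 ℓ.2.1.ne_zero hv hv'
    have h := hrel n hn m ℓ hℓm
    constructor
    · intro h1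
      exact (h.mp fun v' hv' ↦ by rw [huniq v' hv']; exact h1) v hv
    · intro h1
      exact (h.mpr fun v' hv' ↦ by rw [huniq v' hv']; exact h1) v hv
  · -- transport: off the base locus means detected
    refine htrans n q₁ q₂ hn hq₁ hq₂ ?_
    by_contra hall
    push Not at hall
    exact hbl fun m v hv ↦ hall m v hv
  · -- base case at the cores of conductor `∅`
    refine hbase n hn ?_
    rw [mixed_empty_eq_selQP W K p c ι Mix hMix n true, mixed_empty_eq_selQP W K p c ι Mix hMix n false]
    exact h1

end Summit.BirchSwinnertonDyer.BirchSwinnertonDyer.Theorems.AdditiveKoly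

end
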